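import Literature.AlgebraicGeometry.PlaneCurves.AffineNodalCurves
import HarnessLib

/-!
# Nodal affine plane curves, III: lines, constants and pencils of parallel lines

Topic `Literature/AlgebraicGeometry/PlaneCurves`, namespace `Literature.AlgebraicGeometry.PlaneCurves.AffineNodalCurves` (sequel of
`AffineNodalCurves`). Everything here is PROVED over an arbitrary field; no definition, no named fact. Written by the prover seat
`leafhand-hodge-q8symplecticpowers-4` (g5, cell `pub-hsemireg`) for the branch-curve nodality step (S1c, hypothesis `hNod` of
`Summit.…Q8SymplecticPowersRegularOfNodalBranchCurve.stub_regularVeryGeneralQ_of_nodalDoubleCoverFact`) of route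
`HodgeConjecture/Q8SymplecticPowers` (crux K1Q, stmt-HodgeConjecture-24190): in each chart of `𝔽₂` the branch curve is
`(unit) · y · ∏ᵢ (s − λᵢ) · Ψ̃`, and the factors `y`, `s − λᵢ` are the coordinate lines treated here. Honest scope: elementary;
nothing here bears on HC, and S1 ∕ K1Q are NOT proved here.

Source: W. Fulton, *Algebraic Curves* (2008 ed.), §3.1 — a line is a curve of degree one, every point of it is simple with the
line itself as tangent; multiplicities and tangents are unchanged by multiplying the equation by a non-zero constant.

## What is here

* `grad_X_zero_sub_C`, `grad_X_one_sub_C`, `grad_X_sub_C_ne_zero`, `not_isSingularPoint_X_sub_C`, `isNodal_X_sub_C`, `isNodal_X` — coordinate lines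
  are smooth, hence nodal;
* `jac_X_zero_sub_C`, `jac_X_one_sub_C` — transversality to a coordinate line is the non-vanishing of the complementary partial;
* `eval_C_mul_ne_zero_iff`, `isSingularPoint_C_mul_iff`, `IsNodal.C_mul`, `isNodal_C_mul_iff` — non-zero constant factors;
* `isNodal_iff_forall_eval_eq_zero` — nodality is a condition at the points of the curve only;
* `isNodal_prod_X_zero_sub_C` — a product of DISTINCT parallel lines `∏_{λ ∈ Λ} (s − λ)` is nodal (indeed smooth).

## References
* [Fulton2008] W. Fulton, *Algebraic Curves* (2008), §3.1 (multiple points and tangent lines; lines; simple points).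
-/

set_option autoImplicit false

open MvPolynomial

namespace Literature.AlgebraicGeometry.PlaneCurves.AffineNodalCurves

open Literature.AlgebraicGeometry.PlaneCurves.SingularPointsEnvelopes

variable {k : Type*} [Field k] {f g : MvPolynomial (Fin 2) k} {p : Fin 2 → k}

/-! ## Coordinate lines -/

/-- `∇(s − λ) = (1, 0)`. [cite: Fulton2008, §3.1 (lines; simple points)] -/
theorem grad_X_zero_sub_C (c : k) (p : Fin 2 → k) : grad (X 0 - C c : MvPolynomial (Fin 2) k) p = ![1, 0] := by
  funext i
  fin_cases i <;> simp [grad_apply, pderiv_X]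

/-- `∇(y − λ) = (0, 1)`. [cite: Fulton2008, §3.1 (lines; simple points)] -/
theorem grad_X_one_sub_C (c : k) (p : Fin 2 → k) : grad (X 1 - C c : MvPolynomial (Fin 2) k) p = ![0, 1] := by
  funext i
  fin_cases i <;> simp [grad_apply, pderiv_X]

/-- `∇(xᵢ − λ) ≠ 0` (its `i`-th component is `1`). [cite: Fulton2008, §3.1 (every point of a line is simple)] -/
theorem grad_X_sub_C_ne_zero (i : Fin 2) (c : k) (p : Fin 2 → k) :
    grad (X i - C c : MvPolynomial (Fin 2) k) p ≠ 0 := by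
  classical
  intro h
  have hi := congrFun h i
  simp [grad_apply, pderiv_X] at hi

/-- A coordinate line `xᵢ = λ` has no singular point. [cite: Fulton2008, §3.1 (every point of a line is simple)] -/
theorem not_isSingularPoint_X_sub_C (i : Fin 2) (c : k) (p : Fin 2 → k) :
    ¬ IsSingularPoint (X i - C c : MvPolynomial (Fin 2) k) p :=
  fun h => grad_X_sub_C_ne_zero i c p h.2

/-- A coordinate line `xᵢ = λ` is a nodal curve (it is smooth). [cite: Fulton2008, §3.1 (lines; simple points)] -/
theorem isNodal_X_sub_C (i : Fin 2) (c : k) : IsNodal (X i - C c : MvPolynomial (Fin 2) k) :=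
  isNodal_of_forall_not_isSingularPoint (not_isSingularPoint_X_sub_C i c)

/-- A coordinate axis `xᵢ = 0` is a nodal curve. [cite: Fulton2008, §3.1 (lines; simple points)] -/
theorem isNodal_X (i : Fin 2) : IsNodal (X i : MvPolynomial (Fin 2) k) := by
  have h := isNodal_X_sub_C (k := k) i 0
  rwa [map_zero, sub_zero] at h

/-- Transversality to the vertical line `s = λ`: `∇(s − λ) × ∇g = ∂_y g`. [cite: Fulton2008, §3.1 (tangent lines)] -/
theorem jac_X_zero_sub_C (c : k) (g : MvPolynomial (Fin 2) k) (p : Fin 2 → k) :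
    jac (X 0 - C c) g p = grad g p 1 := by
  simp [jac, grad_X_zero_sub_C]

/-- Transversality to the horizontal line `y = λ`: `∇(y − λ) × ∇g = −∂_s g`. [cite: Fulton2008, §3.1 (tangent lines)] -/
theorem jac_X_one_sub_C (c : k) (g : MvPolynomial (Fin 2) k) (p : Fin 2 → k) :
    jac (X 1 - C c) g p = -grad g p 0 := by
  simp [jac, grad_X_one_sub_C]

/-! ## Non-zero constant factors -/

/-- `(c·f)(p) ≠ 0 ↔ f(p) ≠ 0` for `c ≠ 0`. [cite: Fulton2008, §3.1 (equations up to a constant)] -/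
theorem eval_C_mul_ne_zero_iff {c : k} (hc : c ≠ 0) :
    MvPolynomial.eval p (C c * f) ≠ 0 ↔ MvPolynomial.eval p f ≠ 0 := by
  rw [map_mul, eval_C, mul_ne_zero_iff]
  exact ⟨fun h => h.2, fun h => ⟨hc, h⟩⟩

/-- Singular points are unchanged by a non-zero constant factor. [cite: Fulton2008, §3.1 (equations up to a constant)] -/
theorem isSingularPoint_C_mul_iff {c : k} (hc : c ≠ 0) : IsSingularPoint (C c * f) p ↔ IsSingularPoint f p := by
  rw [mul_comm]
  exact isSingularPoint_mul_iff_of_eval_ne_zero (g := C c) (by rwa [eval_C])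

/-- Nodality is unchanged by a non-zero constant factor. [cite: Fulton2008, §3.1 (equations up to a constant)] -/
theorem IsNodal.C_mul {c : k} (hc : c ≠ 0) (hf : IsNodal f) : IsNodal (C c * f) :=
  fun p => isNodalAt_mul_of_eval_ne_zero_left (f := C c) (by rwa [eval_C]) (hf p)

/-- Nodality is unchanged by a non-zero constant factor (iff form). [cite: Fulton2008, §3.1 (equations up to a constant)] -/
theorem isNodal_C_mul_iff {c : k} (hc : c ≠ 0) : IsNodal (C c * f) ↔ IsNodal f := by
  refine ⟨fun h => ?_, IsNodal.C_mul hc⟩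
  have h' := IsNodal.C_mul (inv_ne_zero hc) h
  rwa [← mul_assoc, ← map_mul, inv_mul_cancel₀ hc, map_one, one_mul] at h'

/-- Nodality only needs to be checked at the points of the curve. [cite: Fulton2008, §3.1 (multiple points)] -/
theorem isNodal_iff_forall_eval_eq_zero :
    IsNodal f ↔ ∀ p, MvPolynomial.eval p f = 0 → IsNodalAt f p :=
  ⟨fun h p _ => h p, fun h p hs => h p hs.1 hs⟩

/-! ## Pencils of parallel lines -/

/-- **Distinct parallel lines form a nodal (indeed smooth) curve**: `∏_{λ ∈ Λ} (s − λ)` is nodal for any finite set `Λ`.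
[cite: Fulton2008, §3.1 (lines; simple points)] -/
theorem isNodal_prod_X_zero_sub_C (Λ : Finset k) : IsNodal (∏ c ∈ Λ, (X 0 - C c : MvPolynomial (Fin 2) k)) := by
  classical
  refine IsNodal.prod Λ (fun c => (X 0 - C c : MvPolynomial (Fin 2) k)) (fun c _ => isNodal_X_sub_C 0 c) ?_ ?_
  · intro i _ j _ hij p hi hj
    exfalso
    apply hij
    simp only [map_sub, eval_X, eval_C, sub_eq_zero] at hi hj
    rw [← hi, ← hj]
  · intro i _ j _ l _ hij _ _ p hi hj
    exfalso
    apply hij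
    simp only [map_sub, eval_X, eval_C, sub_eq_zero] at hi hj
    rw [← hi, ← hj]

/-- The same for horizontal lines `∏ (y − λ)`. [cite: Fulton2008, §3.1 (lines; simple points)] -/
theorem isNodal_prod_X_one_sub_C (Λ : Finset k) : IsNodal (∏ c ∈ Λ, (X 1 - C c : MvPolynomial (Fin 2) k)) := by
  classical
  refine IsNodal.prod Λ (fun c => (X 1 - C c : MvPolynomial (Fin 2) k)) (fun c _ => isNodal_X_sub_C 1 c) ?_ ?_
  · intro i _ j _ hij p hi hj
    exfalso
    apply hij
    simp only [map_sub, eval_X, eval_C, sub_eq_zero] at hi hj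
    rw [← hi, ← hj]
  · intro i _ j _ l _ hij _ _ p hi hj
    exfalso
    apply hij
    simp only [map_sub, eval_X, eval_C, sub_eq_zero] at hi hj
    rw [← hi, ← hj]

end Literature.AlgebraicGeometry.PlaneCurves.AffineNodalCurves
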